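import Summits.ResolutionOfSingularities.ResolutionOfSingularities.Theses.FoliationDescent
import Summits.ResolutionOfSingularities.ResolutionOfSingularities.Theorems.PAlterationPialtBridgeFoliationDescent
import HarnessLib

/-!
# `LogCanQuotLU` — negative lemmas, part III: the log-canonical DICHOTOMY is LOAD-BEARING —
# with "non-singular ∨ multiplicative" deleted (but `g ≠ 0` and preservation of `S'_c` KEPT)
# the crux is again RRLU1 over perfect fields, hence — with Temkin 2013 — local uniformization

Support (negative) lemma for crux `stmt-ResolutionOfSingularities-17082`
(`Summit.ResolutionOfSingularities.ResolutionOfSingularities.Theses.FoliationDescent.LogCanQuotLU`,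
route `FoliationDescent`, crux #3 "log-canonical quotients uniformize"), filed by the standing
disprover (cdisprove cycle 1; work file `Cruxes/LogCanQuotLU/Disproof.lean`; companions
`Negative/WithoutRegularTop.lean`, `Negative/WithoutGNeZero.lean`). This file declares NO
definition: the variant statement is written out inline (hypothesis `hQ`), and NO declaration
concludes the route decl `LogCanQuotLU` positively.

`Negative/WithoutGNeZero.lean` deletes `g ≠ 0` and takes `g = 0`, which empties BOTH the
preservation clause and the dichotomy. Sharper: keep `g ≠ 0` and the preservation clause
"`g • D` maps `S'_c` into itself" and delete ONLY the dichotomy "non-singular ∨ multiplicative".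
The hardness survives, because preservation is cheap: for ANY derivation `D` of `L = Frac B` and
any finitely generated `B = k[b₁, …, bₙ]`, the common denominator `g = ∏ dᵢ` of the `D bᵢ = nᵢ/dᵢ`
is a non-zero element of `B` with `(g • D)(B) ⊆ B` (Leibniz on `k`-algebra generators), hence
`(g • D)(B_c) ⊆ B_c` (quotient rule; units of `O` in `B` stay units). So:

* `rrLU1_perfect_of_logCanQuotLU_withoutDichotomy` — the crux with ONLY the dichotomy deleted
  implies RRLU1 over perfect fields (the bridge of `PAlterationPialtBridgeFoliationDescent.lean`
  with `S' := B`, `D = d/dy`, `g =` the common denominator; no `FolLU`);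
* `isLocallyUniformizable_perfect_of_temkin2013_of_logCanQuotLU_withoutDichotomy` — hence, with
  `Temkin2013`, local uniformization of every finitely generated extension of every perfect field
  of characteristic `p` (open from dimension `4`,
  `Literature.Barriers.ResolutionOfSingularities.DimensionFourFrontier`).

Upshot for the provers (with parts I–II): of the crux's hypotheses, exactly "`S'` regular at the
centre" and "`g • D` is NON-SINGULAR or MULTIPLICATIVE on `S'_c`" separate it from the open
problem; `D ≠ 0` is idle; `p`-closedness, perfectness and the finiteness clauses are idle for
truth (the crux follows from relative LU, `Cruxes/LogCanQuotLU/Disproof.lean` §2) and serve only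
the mechanism (Taylor projection / toric normal form).

## Sources
* M. Temkin, Inseparable local uniformization, J. Algebra 373 (2013), Thm. 1.3.2, Rem. 1.3.5.
  [Temkin2013]
* A. N. Rudakov, I. R. Shafarevich, Inseparable morphisms of algebraic surfaces, Izv. 40 (1976),
  §1. [cite: doi:10.1070/im1976v010n06abeh001833]
-/

noncomputable section

set_option linter.dupNamespace false -- mandated namespace of this single-conjunct summit

open IsLocalRing
open Literature.AlgebraicGeometry.Resolution
open Summit.ResolutionOfSingularities.ResolutionOfSingularities.Theorems.Pialt.RadiciallyRegular

namespace Summit.ResolutionOfSingularities.ResolutionOfSingularities.Theorems.LogCanQuotLU.Negative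

/-- **Common denominators**: for a derivation `E` of `L = Frac B`, `B = k[t]` finitely generated,
some non-zero `g ∈ B` has `(g • E)(B) ⊆ B`. [folklore] -/
theorem exists_smul_derivation_map_mem {k L : Type} [Field k] [Field L] [Algebra k L]
    (B : Subalgebra k L) (hBfg : B.FG) [IsFractionRing B L] (E : Derivation k L L) :
    ∃ g : L, g ∈ B ∧ g ≠ 0 ∧ ∀ z ∈ B, (g • E) z ∈ B := by
  classical
  obtain ⟨t, ht⟩ := hBfg
  have hden : ∀ b : L, ∃ d : L, d ∈ B ∧ d ≠ 0 ∧ d * E b ∈ B := fun b => by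
    obtain ⟨n, d, hd, hnd⟩ := IsFractionRing.div_surjective (A := B) (E b)
    have hd0 : (d : L) ≠ 0 := fun h => nonZeroDivisors.ne_zero hd (Subtype.ext h)
    refine ⟨d, d.2, hd0, ?_⟩
    have h : (d : L) * E b = n := by
      rw [← hnd]
      change (d : L) * ((n : L) / (d : L)) = n
      rw [mul_div_cancel₀ _ hd0]
    rw [h]
    exact n.2
  choose d hdB hd0 hdE using hden
  refine ⟨∏ b ∈ t, d b, prod_mem fun b _ => hdB b, Finset.prod_ne_zero_iff.mpr fun b _ => hd0 b,
    fun z hz => ?_⟩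
  have hgen : ∀ b ∈ t, (∏ x ∈ t, d x) * E b ∈ B := fun b hb => by
    have h : (∏ x ∈ t, d x) * E b = (∏ x ∈ t.erase b, d x) * (d b * E b) := by
      rw [← Finset.mul_prod_erase t d hb]
      ring
    rw [h]
    exact B.mul_mem (prod_mem fun x _ => hdB x) (hdE b)
  rw [← ht] at hz ⊢
  refine Algebra.adjoin_induction (fun x hx => ?_) (fun r => ?_) (fun u v _ _ hu hv => ?_)
    (fun u v hu' hv' hu hv => ?_) hz
  · rw [Derivation.smul_apply, smul_eq_mul]
    exact ht ▸ hgen x hx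
  · rw [Derivation.smul_apply, Derivation.map_algebraMap, smul_zero]
    exact Subalgebra.zero_mem _
  · rw [map_add]
    exact Subalgebra.add_mem _ hu hv
  · rw [Derivation.leibniz, smul_eq_mul, smul_eq_mul]
    exact Subalgebra.add_mem _ (Subalgebra.mul_mem _ hu' hv) (Subalgebra.mul_mem _ hv' hu)

section WithoutDichotomy


/-- **The dichotomy "non-singular ∨ multiplicative" is load-bearing**: `LogCanQuotLU` with ONLY
that hypothesis deleted (keeping `g ≠ 0` and the preservation of `S'_c`) implies RRLU1 over
perfect fields — along a height-one Frobenius sandwich `K ⊆ L = K(y)`, `y ^ p ∈ K`, take the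
regular `B` itself as the top, `D = d/dy`, and `g` the common denominator of `D` on generators of
`B` (`exists_smul_derivation_map_mem`), so that `g • D` preserves `B`, hence `B_c`.
[cite: Temkin2013, Rem. 1.3.5 (ii)–(iii)] -/
theorem rrLU1_perfect_of_logCanQuotLU_withoutDichotomy
    (hQ : ∀ p : ℕ, p.Prime → ∀ (k K : Type) [Field k] [CharP k p] [PerfectField k] [Field K]
      [Algebra k K] (O : ValuationSubring K) (S' : Subalgebra k K)
      (h' : S'.toSubring ≤ O.toSubring) (D : Derivation k K K) (g : K) (R : Subalgebra k K),
      S'.FG → IsFractionRing S' K →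
      IsRegularLocalRing (Localization.AtPrime
        (Ideal.comap (Subring.inclusion h') (IsLocalRing.maximalIdeal O))) →
      D ≠ 0 → (∃ c : K, ∀ x : K, (⇑D)^[p] x = c * D x) → g ≠ 0 →
      (∀ x : K, (∃ a b : K, a ∈ S' ∧ b ∈ S' ∧ b ≠ 0 ∧ b⁻¹ ∈ O ∧ x = a / b) →
        ∃ a b : K, a ∈ S' ∧ b ∈ S' ∧ b ≠ 0 ∧ b⁻¹ ∈ O ∧ (g • D) x = a / b) →
      R.FG → R ≤ S' → (∀ x ∈ R, D x = 0) →
      ∃ (A : Subalgebra k K) (hA : A.toSubring ≤ O.toSubring), R ≤ A ∧ A.FG ∧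
        (∀ x ∈ A, D x = 0) ∧
        (∀ x : K, D x = 0 → ∃ a b : K, a ∈ A ∧ b ∈ A ∧ b ≠ 0 ∧ x = a / b) ∧
        IsRegularLocalRing (Localization.AtPrime
          (Ideal.comap (Subring.inclusion hA) (IsLocalRing.maximalIdeal O))))
    (p : ℕ) (hp : p.Prime) :
    ∀ (k K L : Type) [Field k] [CharP k p] [PerfectField k] [Field K] [Field L] [Algebra k K]
      [Algebra K L] [Algebra k L] [IsScalarTower k K L], (⊤ : IntermediateField k K).FG →
      IsPurelyInseparable K L →
      (∃ y : L, y ^ p ∈ (algebraMap K L).range ∧ IntermediateField.adjoin K {y} = ⊤) →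
      ∀ B : Subalgebra k L, B.FG → IsFractionRing B L → IsRegularRing B →
      ∀ O : ValuationSubring L, B.toSubring ≤ O.toSubring →
        IsLocallyUniformizable k K (O.comap (algebraMap K L)) := by
  intro k K L _ _ _ _ _ _ _ _ _ _hfg _hpi hy' B hBfg hBfr hBreg O hBO
  classical
  haveI : Fact p.Prime := ⟨hp⟩
  haveI : CharP K p := charP_of_injective_algebraMap (algebraMap k K).injective p
  haveI := hBfr
  obtain ⟨y, hyp, htop⟩ := hy'
  let f : K →ₐ[k] L := IsScalarTower.toAlgHom k K L
  have hf : (f : K →+* L) = algebraMap K L := rfl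
  rw [← hf]
  by_cases hyK : y ∈ (algebraMap K L).range
  · -- degenerate case `L = K`: the regular `B` itself
    have hsurj : Function.Surjective (algebraMap K L) := by
      intro z
      have hz : z ∈ (⊤ : IntermediateField K L) := IntermediateField.mem_top
      rw [← htop] at hz
      have hle : IntermediateField.adjoin K {y} ≤ ⊥ := by
        rw [IntermediateField.adjoin_le_iff]
        rintro _ rfl
        obtain ⟨c, hc⟩ := hyK
        exact hc ▸ (⊥ : IntermediateField K L).algebraMap_mem c
      obtain ⟨c, hc⟩ := IntermediateField.mem_bot.mp (hle hz)
      exact ⟨c, hc⟩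
    refine isLocallyUniformizable_comap_of_model f O B hBO (fun x _ => hsurj x) hBfg
      (fun z => ?_) (isRegularLocalRing_centre_of_isRegularRing B O hBO)
    obtain ⟨a, b, hb, hab⟩ := IsFractionRing.div_surjective (A := B) (f z)
    exact ⟨a, b, a.2, b.2, fun h => nonZeroDivisors.ne_zero hb (Subtype.ext h), hab.symm⟩
  · -- the height-one step: `D = d/dy`, `g` a common denominator
    obtain ⟨D, hDy, hDK, hDp, hDker⟩ := exists_derivation_heightOne k y hyK hyp htop
    have hD0 : D ≠ 0 := by
      intro h
      rw [h] at hDy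
      exact zero_ne_one hDy
    have hDpc : ∃ c : L, ∀ x : L, (⇑D)^[p] x = c * D x := ⟨0, fun x => by rw [hDp, zero_mul]⟩
    obtain ⟨g, -, hg0, hgD⟩ := exists_smul_derivation_map_mem B hBfg D
    -- `g • D` preserves the local ring `B_c` (quotient rule)
    have hpres : ∀ x : L, (∃ a b : L, a ∈ B ∧ b ∈ B ∧ b ≠ 0 ∧ b⁻¹ ∈ O ∧ x = a / b) →
        ∃ a b : L, a ∈ B ∧ b ∈ B ∧ b ≠ 0 ∧ b⁻¹ ∈ O ∧ (g • D) x = a / b := by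
      rintro x ⟨a, b, ha', hb, hb0, hbO, rfl⟩
      refine ⟨b * (g • D) a - a * (g • D) b, b * b, ?_, B.mul_mem hb hb, mul_ne_zero hb0 hb0,
        ?_, ?_⟩
      · exact B.sub_mem (B.mul_mem hb (hgD a ha')) (B.mul_mem ha' (hgD b hb))
      · rw [mul_inv]
        exact O.mul_mem _ _ hbO hbO
      · rw [Derivation.leibniz_div, smul_eq_mul, smul_eq_mul, smul_eq_mul, div_eq_mul_inv]
        ring
    have hRfg : (⊥ : Subalgebra k L).FG := Subalgebra.fg_bot
    have hRconst : ∀ x ∈ (⊥ : Subalgebra k L), D x = 0 := by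
      intro x hx
      obtain ⟨c, rfl⟩ := Algebra.mem_bot.mp hx
      exact D.map_algebraMap c
    obtain ⟨A, hA, -, hAfg, hAconst, hAfrac, hAreg⟩ :=
      hQ p hp k L O B hBO D g ⊥ hBfg hBfr (isRegularLocalRing_centre_of_isRegularRing B O hBO)
        hD0 hDpc hg0 hpres hRfg bot_le hRconst
    refine isLocallyUniformizable_comap_of_model f O A hA (fun x hx => ?_) hAfg
      (fun z => ?_) hAreg
    · obtain ⟨c, hc⟩ := hDker x (hAconst x hx)
      exact ⟨c, hc⟩
    · obtain ⟨a, b, ha, hb, hb0, hz⟩ := hAfrac (f z) (hDK z)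
      exact ⟨a, b, ha, hb, hb0, hz⟩

/-- **Consequently (with Temkin's inseparable local uniformization) `LogCanQuotLU` without the
dichotomy gives local uniformization of every finitely generated extension of every PERFECT field
of characteristic `p`.** [cite: Temkin2013, Thm. 1.3.2] -/
theorem isLocallyUniformizable_perfect_of_temkin2013_of_logCanQuotLU_withoutDichotomy
    (hQ : ∀ p : ℕ, p.Prime → ∀ (k K : Type) [Field k] [CharP k p] [PerfectField k] [Field K]
      [Algebra k K] (O : ValuationSubring K) (S' : Subalgebra k K)
      (h' : S'.toSubring ≤ O.toSubring) (D : Derivation k K K) (g : K) (R : Subalgebra k K),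
      S'.FG → IsFractionRing S' K →
      IsRegularLocalRing (Localization.AtPrime
        (Ideal.comap (Subring.inclusion h') (IsLocalRing.maximalIdeal O))) →
      D ≠ 0 → (∃ c : K, ∀ x : K, (⇑D)^[p] x = c * D x) → g ≠ 0 →
      (∀ x : K, (∃ a b : K, a ∈ S' ∧ b ∈ S' ∧ b ≠ 0 ∧ b⁻¹ ∈ O ∧ x = a / b) →
        ∃ a b : K, a ∈ S' ∧ b ∈ S' ∧ b ≠ 0 ∧ b⁻¹ ∈ O ∧ (g • D) x = a / b) →
      R.FG → R ≤ S' → (∀ x ∈ R, D x = 0) →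
      ∃ (A : Subalgebra k K) (hA : A.toSubring ≤ O.toSubring), R ≤ A ∧ A.FG ∧
        (∀ x ∈ A, D x = 0) ∧
        (∀ x : K, D x = 0 → ∃ a b : K, a ∈ A ∧ b ∈ A ∧ b ≠ 0 ∧ x = a / b) ∧
        IsRegularLocalRing (Localization.AtPrime
          (Ideal.comap (Subring.inclusion hA) (IsLocalRing.maximalIdeal O))))
    (hT : Temkin2013.{0}) {p : ℕ} [Fact p.Prime] (k : Type) [Field k] [CharP k p]
    [PerfectField k] (K : Type) [Field K] [Algebra k K] (hfg : (⊤ : IntermediateField k K).FG)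
    (O : ValuationSubring K) (hO : ∀ c : k, algebraMap k K c ∈ O) :
    IsLocallyUniformizable k K O :=
  isLocallyUniformizable_of_temkin2013_of_rrLU1_at hT k
    (fun K' L' _ _ _ _ _ _ => rrLU1_perfect_of_logCanQuotLU_withoutDichotomy hQ p Fact.out k K' L')
    K hfg O hO

end WithoutDichotomy

end Summit.ResolutionOfSingularities.ResolutionOfSingularities.Theorems.LogCanQuotLU.Negative

end
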